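import Summits.CriticalPhenomena.CardyFormulaZ2.Theorems.EdgeCoherence.Negative.CornerObservableRigidity
import Literature.Probability.LatticeModels.ExplorationWinding
import Literature.Probability.LatticeModels.MedialWindingBridge

/-!
# `EdgeCoherence` (route `CardyComplexCone`, stmt-CriticalPhenomena-11385): the phase of a passage
# of the exploration path in closed form

By-product of the cdisprove unit for provers of the crux: the integrand `dartPhaseSum` of the corner
observable `cornerObs` (`CornerObservableRigidity.lean`) evaluated on the event that the `k₀`-th
orbit corner is the given corner — the single phase `exp(-(i/3)(π/2) S)`, `S = Σ_{i<k₀} turnSign`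
(number of left minus number of right turns of the exploration before the dart), from
`ExplorationWinding.winding_orbitPts` (every step turns by `±π/2`) and the bridge
`Polyline.winding_eq_winding`.  Hence `E_δ(v, faceAt v k) = E[1_{(v,k) = orbit corner k₀ < exit} · e^{-iπS/6}]`,
the starting formula of the route's twisted two-arm kernel.
-/

noncomputable section

open MeasureTheory Filter Topology
open Literature.Probability.LatticeModels Literature.Probability.RandomPlanarGeometry
open Literature.Probability.Percolation

namespace Summit.CriticalPhenomena.CardyFormulaZ2.Theorems.EdgeCoherence.Negative


section Phase

variable {D : DiscreteDobrushin} (hD : D.IsZdAdmissible) {c₀ : Site 2 × Fin 4}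
  (hc₀ : D.IsStartCorner c₀)
include hD hc₀

/-- The exploration path IS the cut orbit, with exit index `length - 1` (repackaging of
`IsMedialExploration.eq_explorationList`). [folklore] -/
theorem medialExploration_eq_explorationList (ω : BondConfig (Site 2)) :
    medialExploration D ω =
      explorationList (D.bcBondConfig ω) c₀ ((medialExploration D ω).length - 1) := by
  have hγ := isMedialExploration_medialExploration_holds D hD ω
  have h1 := hγ.one_lt_length
  exact hγ.eq_explorationList hD hc₀ (hγ.not_isInnerFace_length hD hc₀) fun k hk =>
    (hγ.dart_eq hD hc₀ k (by omega)).1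

/-- **Closed form of the integrand.**  On the event that the `k₀`-th orbit corner is `p` (before
the exit), the contribution of the corner `(p.1, cFace p)` to `E_δ` is the single phase
`exp(-(i/3) · (π/2) · S)`, `S = Σ_{i<k₀} turnSign` = (#left − #right turns of the exploration
before the dart): by `ExplorationWinding.winding_orbitPts` every step turns by `±π/2`.  So
`E_δ(v, faceAt v k) = E[ 1_{(v,k) ∈ orbit before exit} · e^{-iπ S/6} ]` — the formula the
twisted-kernel mechanism of the route starts from. [folklore] -/
theorem dartPhaseSum_eq_exp_turnSign (ω : BondConfig (Site 2)) {δ : ℝ} (hδ : δ ≠ 0)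
    (p : Site 2 × Fin 4) (k₀ : ℕ) (hk₀ : k₀ + 1 < (medialExploration D ω).length)
    (horb : cornerOrbit (D.bcBondConfig ω) c₀ k₀ = p) :
    dartPhaseSum (medialExploration D ω) δ p.1 (cFace p) =
      Complex.exp (-(Complex.I / 3) * ((Real.pi / 2 *
        ∑ i ∈ Finset.range k₀, (turnSign (D.bcBondConfig ω) (cornerOrbit (D.bcBondConfig ω) c₀ i) : ℝ) : ℝ) : ℂ)) := by
  rw [dartPhaseSum_eq_of_orbit_eq hD hc₀ ω δ p k₀ hk₀ horb]
  congr 4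
  have hN := medialExploration_eq_explorationList hD hc₀ ω
  set N := (medialExploration D ω).length - 1 with hNdef
  rw [hN, map_medialPoint_explorationList, take_orbitPts δ c₀ (show k₀ + 1 ≤ N by omega),
    Polyline.winding_eq_winding, winding_orbitPts hδ, sum_turnOf_eq]
  simp

end Phase


end Summit.CriticalPhenomena.CardyFormulaZ2.Theorems.EdgeCoherence.Negative

end
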